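import Summits.BirchSwinnertonDyer.Rank1Residual.O5.GssSplitThree
import Summits.BirchSwinnertonDyer.Rank1Residual.Additive.GordTwistOrdinary
import Summits.BirchSwinnertonDyer.Rank1Residual.Additive.GordTwistMinimalModel
import Summits.BirchSwinnertonDyer.Rank1Residual.Additive.DictionaryUniform
import Summits.BirchSwinnertonDyer.Rank1Residual.GaloisImage.NonsplitCartanDictionary
import HarnessLib

/-!
# BSD rank-≤1 residual cell, class O5 — the `(G) ∧ ss` twist dictionary at EVERY odd prime:
# `SubGss W p ↔ SubGord W p ∧ GoodSS Wd p` for any globally minimal `Wd ≅ E^{(p*)}`, and the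
# SUPPLY theorem `SubGss W p → ∃ Wd, C • E^{(p*)} = Wd ∧ GoodSS Wd p`

HONEST FRAMING (cell `b2b-bsdres-*`, run/shared/lean/b2b/bsd-rank1-residual/, verbatim): the goal
of the cell is to DELETE the COMBINATION-SHAPED residual classes for ALL analytic-rank `≤ 1` elliptic
curves over `ℚ`, not to book instances; census / certificate output is EVIDENCE, never a Literature
fact; nothing here is booked, no mark is moved, O5 stays OPEN. This file is pure bookkeeping over
tree theorems: 0 definitions, 0 named facts, 0 conjecture nodes.

## What this file does (CLASS-CLOSURE lane, typer 5 = O5/O6 typer of record; ask of n1011-p04-g2,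
## INBOX 2026-08-21T06:20Z: "a supply theorem `SubGss → ∃ Wd, GoodSS Wd p` would make
## `exists_le_normalizer_unitGroup_of_goodSS_twist_of_not_surj` a one-liner on the census predicate")

The census cell **(G) ∧ ss** of the odd additive locus is the tree predicate
`Additive.SubGss W p := SubGord W p ∧ ¬ TypeGOrd W p` (`Additive/PotSupersingularClasses.lean`).
The image-shape theorems of `GaloisImage/SupersingularTwistNonsplitCartan.lean` and
`GaloisImage/NonsplitCartanDictionary.lean` (n1011-p04, T-O8c) take instead the twist DATUM
"`C • W.quadraticTwist d = Wd` with `GoodSS Wd p`". This file closes the gap at every odd `p`: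

* `not_typeGOrd_of_goodSS_twist_pStar` — if some globally minimal model `Wd` of `E^{(p*)}`
  (`p* = (−1)^{⌊p/2⌋} p`) is good SUPERSINGULAR at `p`, then `¬ TypeGOrd W p` (no additivity, no
  `e = 2` needed: `goodOrd_of_typeGOrd_of_hasGoodReductionAtPrime`).
* `goodSS_twist_pStar_of_subGss` — conversely `SubGss W p` (with `Addv W p`, `p` odd) forces EVERY
  globally minimal model of `E^{(p*)}` to be good supersingular at `p`: at `p = 3` this is gen 2's
  `subGss_three_iff_subGord_and_goodSS_twist` (`GssSplitThree.lean`, `p* = −3`); at `p ≥ 5` it is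
  `SubGss.subGordTwo` (`e = 2`) + `hasGoodReductionAtPrime_twist_pStar` (the twist is GOOD) +
  `typeGOrd_of_goodOrd_quadraticTwist` (were it ordinary, `E` would be (G)-ordinary).
* `subGss_iff_subGord_and_goodSS_twist_pStar` — the census rule "(G) and `p ∣ a_p(E^{(p*)})`" IS
  the theory class, at every odd additive `p` (the `p = 3` file had it at `3` only).
* `exists_goodSS_twist_pStar_of_subGss` — the SUPPLY theorem (Néron: `exists_minimal_twist_pStar`).
* Consumers, one-liners on the census predicate: `hasNonsplitCartanModPImage_of_subGss_of_not_surj`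
  (`SubGss ∧ ¬ surj(p)` ⟹ image in a non-split Cartan normaliser, Serre's shape) and
  `surj_of_subGss_of_not_hasCM_of_nonsplitCartanPointsAreCM` (granted "`X_ns⁺(p)(ℚ)` is CM" — a
  THEOREM in print only at `p = 13, 17` — a non-CM `(G) ∧ ss` pair has surjective `ρ̄_{E,p}`).

References: D. Delbourgo, Compositio Math. 113 (1998) §1.5 hypothesis (G) [Delbourgo1998];
J. H. Silverman, *AEC* VII.1 Prop. 1.3(b), VIII.8.3 [SilvermanAEC2009]; J.-P. Serre, *Propriétés
galoisiennes des points d'ordre fini des courbes elliptiques*, Invent. Math. 15 (1972) §2.2, and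
Kyoto 1977 questions 6.5–6.6 [SerreKyoto1977].
-/

noncomputable section

open scoped Classical NumberField

open WeierstrassCurve Literature.NumberTheory.EllipticCurves
  Literature.NumberTheory.EllipticCurves.Rank1Residual
  Literature.NumberTheory.SerreUniformity
  Summit.BirchSwinnertonDyer.Rank1Residual.Additive
  Summit.BirchSwinnertonDyer.Rank1Residual.GaloisImage

namespace Summit.BirchSwinnertonDyer.Rank1Residual.O5

section Dictionary

variable (W : WeierstrassCurve ℚ) [W.IsElliptic] [W.IsGloballyMinimal] (p : ℕ) [hp : Fact p.Prime]

/-- The cell's twist parameter `p* = (−1)^{⌊p/2⌋}·p` is nonzero. [folklore] -/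
theorem pStar_ne_zero : ((-1 : ℚ) ^ (p / 2) * p : ℚ) ≠ 0 :=
  mul_ne_zero (pow_ne_zero _ (by norm_num)) (by exact_mod_cast hp.out.ne_zero)

omit [W.IsGloballyMinimal] in
/-- **A good SUPERSINGULAR `p*`-twist rules out (G)-ordinary** (`p` odd; no additivity and no
`e = 2` hypothesis): if a globally minimal model `Wd` of `E^{(p*)}` has `GoodSS Wd p`, then
`¬ TypeGOrd W p` — were `E` (G)-ordinary, `Wd` would be good ORDINARY at `p`
(`goodOrd_of_typeGOrd_of_hasGoodReductionAtPrime`), contradicting `p ∣ a_p(Wd)`.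
[cite: Delbourgo1998, §1.5 (G)] -/
theorem not_typeGOrd_of_goodSS_twist_pStar (hp2 : p ≠ 2) (Wd : WeierstrassCurve ℚ) [Wd.IsElliptic]
    [Wd.IsGloballyMinimal] (C : VariableChange ℚ)
    (hWd : C • W.quadraticTwist ((-1 : ℚ) ^ (p / 2) * p) = Wd) (hss : GoodSS Wd p) :
    ¬ TypeGOrd W p := fun hG ↦
  (goodOrd_of_typeGOrd_of_hasGoodReductionAtPrime W p hp2 hG Wd ⟨C, hWd⟩ hss.1).2 hss.2

/-- `(G)` and a good supersingular `p*`-twist give the census cell `(G) ∧ ss`. [folklore] -/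
theorem subGss_of_subGord_of_goodSS_twist_pStar (hp2 : p ≠ 2) (hS : SubGord W p)
    (Wd : WeierstrassCurve ℚ) [Wd.IsElliptic] [Wd.IsGloballyMinimal] (C : VariableChange ℚ)
    (hWd : C • W.quadraticTwist ((-1 : ℚ) ^ (p / 2) * p) = Wd) (hss : GoodSS Wd p) : SubGss W p :=
  ⟨hS, not_typeGOrd_of_goodSS_twist_pStar W p hp2 Wd C hWd hss⟩

/-- **`(G) ∧ ss` forces the `p*`-twist to be GOOD SUPERSINGULAR** (`p` odd, `E` additive at `p`):
for `SubGss W p` and ANY globally minimal model `Wd` of `E^{(p*)}`, `GoodSS Wd p`. At `p = 3`: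
`subGss_three_iff_subGord_and_goodSS_twist` (`p* = −3`). At `p ≥ 5`: `(G) ∧ ss` has `e = 2`
(`SubGss.subGordTwo`; case split `eq_three_or_five_le_of_prime_ne_two` of
`DictionaryUniform.lean`), so `Wd` is good at `p` (`hasGoodReductionAtPrime_twist_pStar`, from
`ord_p j ≥ 0` and `ord_p Δ_min ≡ 6 (mod 12)`), and `p ∣ a_p(Wd)` since otherwise
`typeGOrd_of_goodOrd_quadraticTwist` would make `E` (G)-ordinary. [cite: Delbourgo1998, §1.5 (G)] -/
theorem goodSS_twist_pStar_of_subGss (hp2 : p ≠ 2) (hadd : Addv W p) (h : SubGss W p)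
    (Wd : WeierstrassCurve ℚ) [Wd.IsElliptic] [Wd.IsGloballyMinimal] (C : VariableChange ℚ)
    (hWd : C • W.quadraticTwist ((-1 : ℚ) ^ (p / 2) * p) = Wd) : GoodSS Wd p := by
  rcases eq_three_or_five_le_of_prime_ne_two p hp.out hp2 with rfl | hp5
  · have hWd' : C • W.quadraticTwist (-3) = Wd := by rw [pstar_three] at hWd; exact hWd
    exact ((subGss_three_iff_subGord_and_goodSS_twist W hadd Wd C hWd').mp h).2
  · have he : semistabilityIndex W p = 2 := (SubGss.subGordTwo W p hp2 hadd h).2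
    have hj : 0 ≤ padicValRat p W.j := not_lt.mp h.1.1
    have hgood : Wd.HasGoodReductionAtPrime p :=
      hasGoodReductionAtPrime_twist_pStar W p hp5 hj ((semistabilityIndex_eq_two_iff W p).mp he)
        Wd C hWd
    refine ⟨hgood, ?_⟩
    by_contra hndvd
    exact h.2 (typeGOrd_of_goodOrd_quadraticTwist W p hp2 Wd C hWd ⟨hgood, hndvd⟩)

/-- **The census rule for `(G) ∧ ss` at every odd additive prime.** For `E` additive at an odd `p`
and any globally minimal model `Wd` of `E^{(p*)}`: `SubGss W p ↔ SubGord W p ∧ GoodSS Wd p` —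
"(G) and the twist by `χ_{p*}` is good SUPERSINGULAR at `p`" (`p ∣ a_p`, i.e. `a_p(E^{(p*)}) = 0`
for `p ≥ 5`, `a₃ ∈ {0, ±3}` at `3`). Generalises gen 2's `subGss_three_iff_subGord_and_goodSS_twist`
from `p = 3` to all odd `p`. [cite: Delbourgo1998, §1.5 (G)] -/
theorem subGss_iff_subGord_and_goodSS_twist_pStar (hp2 : p ≠ 2) (hadd : Addv W p)
    (Wd : WeierstrassCurve ℚ) [Wd.IsElliptic] [Wd.IsGloballyMinimal] (C : VariableChange ℚ)
    (hWd : C • W.quadraticTwist ((-1 : ℚ) ^ (p / 2) * p) = Wd) :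
    SubGss W p ↔ SubGord W p ∧ GoodSS Wd p :=
  ⟨fun h ↦ ⟨h.1, goodSS_twist_pStar_of_subGss W p hp2 hadd h Wd C hWd⟩,
    fun h ↦ subGss_of_subGord_of_goodSS_twist_pStar W p hp2 h.1 Wd C hWd h.2⟩

/-- **SUPPLY theorem** (the twist datum of the GaloisImage / descent files, PRODUCED from the census
cell): for `SubGss W p` (`p` odd, `E` additive at `p`) there is a globally minimal model `Wd` of
`E^{(p*)}` (Néron, `exists_minimal_twist_pStar`) with `GoodSS Wd p`.
[cite: SilvermanAEC2009, VIII.8.3] [cite: Delbourgo1998, §1.5 (G)] -/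
theorem exists_goodSS_twist_pStar_of_subGss (hp2 : p ≠ 2) (hadd : Addv W p) (h : SubGss W p) :
    ∃ (Wd : WeierstrassCurve ℚ) (_ : Wd.IsElliptic) (_ : Wd.IsGloballyMinimal)
      (C : VariableChange ℚ), C • W.quadraticTwist ((-1 : ℚ) ^ (p / 2) * p) = Wd ∧ GoodSS Wd p := by
  obtain ⟨Wd, hE, hM, C, hC⟩ := exists_minimal_twist_pStar p W
  exact ⟨Wd, hE, hM, C, hC, goodSS_twist_pStar_of_subGss W p hp2 hadd h Wd C hC⟩

/-- The O5 class splits as `(G) ∧ ss` or `(t′)`; on its `(G) ∧ ss` half the supply theorem applies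
with the class's own `p ≠ 2 ∧ Addv W p`. [folklore] -/
theorem exists_goodSS_twist_pStar_of_classO5_of_subGss (hO : ClassO5 W p) (h : SubGss W p) :
    ∃ (Wd : WeierstrassCurve ℚ) (_ : Wd.IsElliptic) (_ : Wd.IsGloballyMinimal)
      (C : VariableChange ℚ), C • W.quadraticTwist ((-1 : ℚ) ^ (p / 2) * p) = Wd ∧ GoodSS Wd p :=
  exists_goodSS_twist_pStar_of_subGss W p hO.1 hO.2.1 h

end Dictionary

/-! ## Consumers: the image-shape theorems of T-O8c on the census predicate (one-liners) -/

section Consumers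

variable (W : WeierstrassCurve ℚ) [W.IsElliptic] [W.IsGloballyMinimal] (p : ℕ) [hp : Fact p.Prime]

/-- **`(G) ∧ ss` and `ρ̄_{E,p}` not onto ⟹ non-split Cartan normaliser image** (`p` odd, `E`
additive at `p`): `SerreUniformity.HasNonsplitCartanModPImage W p`. The supply theorem feeds
n1011-p04's `hasNonsplitCartanModPImage_of_goodSS_twist_of_not_surj` (frame transport along
`W[p] ≃ Wd[p] ⊗ χ`, supersingular image inside `N(kˣ)`, Serre §2.2). This is the THEORY statement
behind the census observation "every `(G-ss, e = 2)` O8 row at `p = 5` carries `5Nn`".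
[cite: SerreKyoto1977, questions 6.5–6.6, pp. 187–188] -/
theorem hasNonsplitCartanModPImage_of_subGss_of_not_surj (hp2 : p ≠ 2) (hadd : Addv W p)
    (h : SubGss W p) (hns : ¬ Surj W p) : HasNonsplitCartanModPImage W p := by
  obtain ⟨Wd, hE, hM, C, hC, hss⟩ := exists_goodSS_twist_pStar_of_subGss W p hp2 hadd h
  exact hasNonsplitCartanModPImage_of_goodSS_twist_of_not_surj W p hp2 (pStar_ne_zero p) Wd ⟨C, hC⟩
    hss hns

/-- **Where Serre uniformity enters O5a.** Granted `NonsplitCartanPointsAreCM p` ("every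
`ℚ`-point of `X_ns⁺(p)` is CM" — a THEOREM in print only for `p = 13, 17`, OPEN for `p ≥ 19`; a
BINDER, nothing asserted), a non-CM curve in the census cell `(G) ∧ ss` at an odd additive `p` has
SURJECTIVE `ρ̄_{E,p}`. One-liner on n1011-p04's `surj_of_goodSS_twist_of_not_hasCM_of_nonsplitCartanPointsAreCM`.
[cite: SerreKyoto1977, questions 6.5–6.6, pp. 187–188] -/
theorem surj_of_subGss_of_not_hasCM_of_nonsplitCartanPointsAreCM (hX : NonsplitCartanPointsAreCM p)
    (hp2 : p ≠ 2) (hadd : Addv W p) (h : SubGss W p) (hCM : ¬ W.HasCM) : Surj W p := by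
  obtain ⟨Wd, hE, hM, C, hC, hss⟩ := exists_goodSS_twist_pStar_of_subGss W p hp2 hadd h
  exact surj_of_goodSS_twist_of_not_hasCM_of_nonsplitCartanPointsAreCM W p hX hp2 (pStar_ne_zero p)
    Wd ⟨C, hC⟩ hss hCM

end Consumers

end Summit.BirchSwinnertonDyer.Rank1Residual.O5

end
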